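import Summits.Ventures.HSemireg.WedgeHankelRecurrenceGaussQuotientDifference

/-!
# Venture HSemireg — **THE DISCRETE CLASSICAL FAMILIES IN STIELTJES' COORDINATES (Charlier, Meixner, Krawtchouk)**: the monic CHARLIER recurrence `a_n = n + c`, `b_{n+1} = c(n+1)` has birth–death
# data `λ_n = c`, `μ_n = n`, so `(−1)^n C_n(0) = c^n`, its zeros are positive, sum to `(t+1)(t∕2 + c)` and lie below `(√t + √c)²`; MEIXNER `a_n = ((1+γ)n + βγ)∕(1−γ)`,
# `b_{n+1} = γ(n+1)(n+β)∕(1−γ)²` has `λ_n = γ(n+β)∕(1−γ)`, `μ_n = n∕(1−γ)`, positive zeros and `(−1)^n M_n(0) = ∏_{k<n} γ(k+β)∕(1−γ)`; KRAWTCHOUK `a_n = p(N−n) + (1−p)n`,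
# `b_{n+1} = p(1−p)(n+1)(N−n)` has `λ_n = p(N−n)`, `μ_n = (1−p)n`, `(−1)^n K_n(0) = p^n N(N−1)⋯(N−n+1)`, and for `t + 1 ≤ N` ALL ZEROS OF `K_{t+1}` LIE IN `(0, N)` (Wall–Wetzel at both ends)

HONEST FRAMING. Part of the Lean index of the computation cell `pub-hsemireg` (seat p10 gen 46, Sunday typer «UNIFORM-IN-n»).  Real polynomials, finite sums ∕ products and `Real.sqrt` only; no variety,
no cohomology theory, no sheaf, no Ext group and no semiregularity map is constructed here; nothing here says that HC / HC_CM / HC_AV holds; no Literature fact (unproved `Prop`) is declared or used.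
Custodian versions as in `WedgeHankelSiegelIdeal` (1/3).
SOURCES (cited).  R. Koekoek, P. A. Lesky, R. F. Swarttouw, *Hypergeometric Orthogonal Polynomials and Their q-Analogues* (2010), (9.14.4) Charlier, (9.10.4) Meixner, (9.11.4) Krawtchouk (normalized
recurrences); T. S. Chihara, *An Introduction to Orthogonal Polynomials* (1978), Ch. VI §1–§3 and Ch. I §9; S. Karlin, J. McGregor, *Linear growth, birth and death processes*, J. Math. Mech. 7
(1958) 643–662 (the linear rates); G. Szegő, *Orthogonal Polynomials*, §2.8–2.82.
PROOF TYPED HERE.  Each family's data identities feed N373 (`recurrence_alt_eval_zero_of_birthDeath`, `zeros_pos_of_birthDeath`), N298 `sum_recurrence_zeros`, N372 (`zeros_lt_of_wall_quarter` for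
Charlier with `c' = √(ct)`; `zeros_lt_of_chain` for Krawtchouk with `B = N`, `g_n = p n ∕ (N − a_n)`, equality).
DEDUP DISCLOSURE (`rg -n -i 'charlier|meixner|krawtchouk' Summits/Ventures/HSemireg Literature`, 2026-09-03): nothing.  The 7 names below: 0 hits tree-wide.

WHAT IS IN THE TREE.  N373, N372, N298 `sum_recurrence_zeros`, N279 `recurrence_zeros_interlace`.
THIS FILE (namespace `Summit.Ventures.HSemireg.Wedge.HankelOuter` continued; CHAINED on N380 (import only); 0 definitions):
* §1146 **`charlier_alt_eval_zero`**, **`charlier_zeros`** (positive, sum, `< (√t + √c)²` for `t ≥ 1`), `meixner_alt_eval_zero`, `meixner_zeros_pos`, `krawtchouk_alt_eval_zero`,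
  **`krawtchouk_zeros_mem`** (`0 < x < N` for `t + 1 ≤ N`), `krawtchouk_zeros_sum` (`Σ x_k = Σ_{n ≤ t} (p(N−n) + (1−p)n)`).
CAVEATS.  Families enter through their recurrences only (no weights ∕ orthogonality sums typed); for Krawtchouk the coupling sequence is prescribed only for `n + 1 ≤ N` (any positive continuation).
Nothing Ext-side.  New names only.
-/

open Module Polynomial
open scoped Matrix Polynomial

namespace Summit.Ventures.HSemireg.Wedge.HankelOuter

/-! ## §1146. Charlier, Meixner, Krawtchouk -/

/-- **CHARLIER: `(−1)^n C_n(0) = c^n`** for the monic recurrence `a_n = n + c`, `b_{n+1} = c(n+1)`. [KLS (9.14.4); Chihara VI §1; this file, §1146] -/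
theorem charlier_alt_eval_zero {Q : ℕ → ℝ[X]} {a b : ℕ → ℝ} {c : ℝ} (hQ0 : Q 0 = 1) (hQ1 : Q 1 = Polynomial.X - C (a 0))
    (hQrec : ∀ n, Q (n + 2) = (Polynomial.X - C (a (n + 1))) * Q (n + 1) - C (b (n + 1)) * Q n) (ha : ∀ n, a n = n + c) (hb : ∀ n, b (n + 1) = c * ((n : ℝ) + 1)) (n : ℕ) :
    (-1 : ℝ) ^ n * (Q n).eval 0 = c ^ n := by
  rw [recurrence_alt_eval_zero_of_birthDeath hQ0 hQ1 hQrec (t := n) (l := fun _ => c) (m := fun k => (k : ℝ)) (by simp) (fun k _ => by rw [ha]; ring)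
    (fun k _ => by rw [hb]; push_cast; ring) n (by omega), Finset.prod_const, Finset.card_range]

/-- **CHARLIER ZEROS (`c > 0`): `t + 1` simple positive zeros with `Σ x_k = (t+1)(t∕2 + c)`, and `x_k < (√t + √c)²` when `t ≥ 1`.** [Chihara VI §1; N372 ∕ N373; this file, §1146] -/
theorem charlier_zeros {Q : ℕ → ℝ[X]} {a b : ℕ → ℝ} {c : ℝ} (hQ0 : Q 0 = 1) (hQ1 : Q 1 = Polynomial.X - C (a 0))
    (hQrec : ∀ n, Q (n + 2) = (Polynomial.X - C (a (n + 1))) * Q (n + 1) - C (b (n + 1)) * Q n) (ha : ∀ n, a n = n + c) (hb : ∀ n, b (n + 1) = c * ((n : ℝ) + 1)) (hc : 0 < c)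
    (hb0 : 0 < b 0) (t : ℕ) :
    ∃ x : Fin (t + 1) → ℝ, StrictMono x ∧ Q (t + 1) = ∏ k, (Polynomial.X - C (x k)) ∧ (∀ k, 0 < x k) ∧ ∑ k, x k = ((t : ℝ) + 1) * ((t : ℝ) / 2 + c) ∧
      (1 ≤ t → ∀ k, x k < (Real.sqrt t + Real.sqrt c) ^ 2) := by
  have hbpos : ∀ j, 0 < b j := fun j => by
    rcases j with _ | k
    · exact hb0
    · rw [hb]; positivity
  obtain ⟨x, -, hx, -, hxq, -, -⟩ := recurrence_zeros_interlace hQ0 hQ1 hQrec hbpos t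
  have hroot : ∀ k, (Q (t + 1)).eval (x k) = 0 := fun k => by rw [hxq, eval_prod]; exact Finset.prod_eq_zero (Finset.mem_univ k) (by simp)
  have hpos := zeros_pos_of_birthDeath hQ0 hQ1 hQrec hbpos (t := t) (l := fun _ => c) (m := fun k => (k : ℝ)) (by simp) (fun _ _ => hc) (fun k _ => by rw [ha]; ring)
    (fun k _ => by rw [hb]; push_cast; ring)
  have hsum : ∀ m : ℕ, ∑ i ∈ Finset.range (m + 1), ((i : ℝ) + c) = ((m : ℝ) + 1) * ((m : ℝ) / 2 + c) := by
    intro m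
    induction m with
    | zero => simp
    | succ m ih => rw [Finset.sum_range_succ, ih]; push_cast; ring
  refine ⟨x, hx, hxq, fun k => hpos _ (hroot k), by rw [sum_recurrence_zeros hQ0 hQ1 hQrec hxq, Finset.sum_congr rfl fun i _ => ha i, hsum], fun ht k => ?_⟩
  have ht' : (1 : ℝ) ≤ t := by exact_mod_cast ht
  have hct : 0 < c * t := by positivity
  have hbound := zeros_lt_of_wall_quarter hQ0 hQ1 hQrec hbpos (t := t) (B := t + c + 2 * Real.sqrt (c * t)) (c := Real.sqrt (c * t)) (Real.sqrt_pos.2 hct)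
    (fun n hn => by rw [ha]; have : (n : ℝ) ≤ t := (by exact_mod_cast hn); linarith) (fun n hn => by
      rw [hb, Real.sq_sqrt hct.le]; have : (n : ℝ) + 1 ≤ t := (by exact_mod_cast hn); nlinarith) (x k) (hroot k)
  have hsq : (Real.sqrt t + Real.sqrt c) ^ 2 = t + c + 2 * Real.sqrt (c * t) := by
    rw [add_sq, Real.sq_sqrt (by positivity), Real.sq_sqrt hc.le, Real.sqrt_mul hc.le, mul_comm (Real.sqrt c)]; ring
  rw [hsq]; exact hbound

/-- **MEIXNER: `(−1)^n M_n(0) = ∏_{k<n} γ(k + β)∕(1 − γ)`** for the monic recurrence `a_n = ((1+γ)n + βγ)∕(1−γ)`, `b_{n+1} = γ(n+1)(n+β)∕(1−γ)²` (`γ ≠ 1`). [KLS (9.10.4); Chihara VI §3; this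
file, §1146] -/
theorem meixner_alt_eval_zero {Q : ℕ → ℝ[X]} {a b : ℕ → ℝ} {β γ : ℝ} (hQ0 : Q 0 = 1) (hQ1 : Q 1 = Polynomial.X - C (a 0))
    (hQrec : ∀ n, Q (n + 2) = (Polynomial.X - C (a (n + 1))) * Q (n + 1) - C (b (n + 1)) * Q n) (hγ : γ ≠ 1)
    (ha : ∀ n, a n = ((1 + γ) * n + β * γ) / (1 - γ)) (hb : ∀ n, b (n + 1) = γ * ((n : ℝ) + 1) * ((n : ℝ) + β) / (1 - γ) ^ 2) (n : ℕ) :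
    (-1 : ℝ) ^ n * (Q n).eval 0 = ∏ k ∈ Finset.range n, γ * ((k : ℝ) + β) / (1 - γ) := by
  have h1 : (1 - γ) ≠ 0 := sub_ne_zero.2 (Ne.symm hγ)
  exact recurrence_alt_eval_zero_of_birthDeath hQ0 hQ1 hQrec (t := n) (l := fun k => γ * ((k : ℝ) + β) / (1 - γ)) (m := fun k => (k : ℝ) / (1 - γ)) (by simp)
    (fun k _ => by rw [ha]; field_simp; ring) (fun k _ => by rw [hb]; field_simp; push_cast; ring) n (by omega)

/-- **MEIXNER ZEROS ARE POSITIVE** (`β > 0`, `0 < γ < 1`). [Chihara VI §3; N373; this file, §1146] -/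
theorem meixner_zeros_pos {Q : ℕ → ℝ[X]} {a b : ℕ → ℝ} {β γ : ℝ} (hQ0 : Q 0 = 1) (hQ1 : Q 1 = Polynomial.X - C (a 0))
    (hQrec : ∀ n, Q (n + 2) = (Polynomial.X - C (a (n + 1))) * Q (n + 1) - C (b (n + 1)) * Q n) (hβ : 0 < β) (hγ0 : 0 < γ) (hγ1 : γ < 1)
    (ha : ∀ n, a n = ((1 + γ) * n + β * γ) / (1 - γ)) (hb : ∀ n, b (n + 1) = γ * ((n : ℝ) + 1) * ((n : ℝ) + β) / (1 - γ) ^ 2) (hb0 : 0 < b 0) (t : ℕ) :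
    ∀ s, (Q (t + 1)).eval s = 0 → 0 < s := by
  have h1 : 0 < 1 - γ := by linarith
  have hbpos : ∀ j, 0 < b j := fun j => by
    rcases j with _ | k
    · exact hb0
    · rw [hb]; positivity
  exact zeros_pos_of_birthDeath hQ0 hQ1 hQrec hbpos (t := t) (l := fun k => γ * ((k : ℝ) + β) / (1 - γ)) (m := fun k => (k : ℝ) / (1 - γ)) (by simp) (fun k _ => by positivity)
    (fun k _ => by rw [ha]; field_simp; ring) (fun k _ => by rw [hb]; field_simp; push_cast; ring)

/-- **KRAWTCHOUK: `(−1)^n K_n(0) = p^n · N(N−1)⋯(N−n+1)`** (`n ≤ N`) for the monic recurrence `a_n = p(N−n) + (1−p)n`, `b_{n+1} = p(1−p)(n+1)(N−n)` (`n + 1 ≤ N`). [KLS (9.11.4); Szegő §2.82; this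
file, §1146] -/
theorem krawtchouk_alt_eval_zero {Q : ℕ → ℝ[X]} {a b : ℕ → ℝ} {p : ℝ} {N : ℕ} (hQ0 : Q 0 = 1) (hQ1 : Q 1 = Polynomial.X - C (a 0))
    (hQrec : ∀ n, Q (n + 2) = (Polynomial.X - C (a (n + 1))) * Q (n + 1) - C (b (n + 1)) * Q n) (ha : ∀ n, a n = p * ((N : ℝ) - n) + (1 - p) * n)
    (hb : ∀ n, n + 1 ≤ N → b (n + 1) = p * (1 - p) * ((n : ℝ) + 1) * ((N : ℝ) - n)) {n : ℕ} (hn : n ≤ N) :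
    (-1 : ℝ) ^ n * (Q n).eval 0 = p ^ n * ∏ k ∈ Finset.range n, ((N : ℝ) - k) := by
  rcases n with _ | m
  · simp [hQ0]
  · rw [recurrence_alt_eval_zero_of_birthDeath hQ0 hQ1 hQrec (t := m) (l := fun k => p * ((N : ℝ) - k)) (m := fun k => (1 - p) * (k : ℝ)) (by simp)
      (fun k _ => by rw [ha]) (fun k hk => by rw [hb k (by omega)]; push_cast; ring) (m + 1) le_rfl, Finset.prod_mul_distrib, Finset.prod_const, Finset.card_range]

/-- **KRAWTCHOUK ZEROS LIE IN `(0, N)`** for `0 < p < 1` and `t + 1 ≤ N` (birth–death data `λ_n = p(N−n) > 0`, `μ_n = (1−p)n` at the left end; the chain parameters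
`g_n = p n ∕ (N − a_n)` give equality in Wall–Wetzel at the right end `B = N`). [Szegő §2.82; Chihara VI §2; this file, §1146] -/
theorem krawtchouk_zeros_mem {Q : ℕ → ℝ[X]} {a b : ℕ → ℝ} {p : ℝ} {N : ℕ} (hQ0 : Q 0 = 1) (hQ1 : Q 1 = Polynomial.X - C (a 0))
    (hQrec : ∀ n, Q (n + 2) = (Polynomial.X - C (a (n + 1))) * Q (n + 1) - C (b (n + 1)) * Q n) (hp0 : 0 < p) (hp1 : p < 1) (ha : ∀ n, a n = p * ((N : ℝ) - n) + (1 - p) * n)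
    (hb : ∀ n, n + 1 ≤ N → b (n + 1) = p * (1 - p) * ((n : ℝ) + 1) * ((N : ℝ) - n)) (hbpos : ∀ j, 0 < b j) {t : ℕ} (htN : t + 1 ≤ N) :
    ∀ s, (Q (t + 1)).eval s = 0 → 0 < s ∧ s < N := by
  have hNn : ∀ n, n ≤ t → (0 : ℝ) < (N : ℝ) - n := fun n hn => by
    have : (n : ℝ) + 1 ≤ N := by exact_mod_cast (show n + 1 ≤ N by omega)
    linarith
  have hlow := zeros_pos_of_birthDeath hQ0 hQ1 hQrec hbpos (t := t) (l := fun k => p * ((N : ℝ) - k)) (m := fun k => (1 - p) * (k : ℝ)) (by simp)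
    (fun k hk => mul_pos hp0 (hNn k hk)) (fun k _ => by rw [ha]) (fun k hk => by rw [hb k (by omega)]; push_cast; ring)
  -- right end: Wall–Wetzel with `B = N`, `g_n = p n / (N − a_n)` where `N − a_n = (1−p)(N−n) + p n`
  have hden : ∀ n, n ≤ t → 0 < (1 - p) * ((N : ℝ) - n) + p * n := fun n hn => by
    have := hNn n hn; have : (0 : ℝ) ≤ n := Nat.cast_nonneg n; nlinarith
  have hNa : ∀ n, (N : ℝ) - a n = (1 - p) * ((N : ℝ) - n) + p * n := fun n => by rw [ha]; ring
  have hup := zeros_lt_of_chain hQ0 hQ1 hQrec hbpos (t := t) (B := (N : ℝ)) (g := fun n => p * n / ((1 - p) * ((N : ℝ) - n) + p * n))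
    (fun n hn => by have := hden n hn; rw [← sub_pos, hNa]; exact this)
    (fun n hn => ⟨div_nonneg (by positivity) (hden n hn).le, (div_lt_one (hden n hn)).2 (by nlinarith [hNn n hn])⟩) fun n hn => le_of_eq ?_
  · exact fun s hs => ⟨hlow s hs, hup s hs⟩
  · have h0 := (hden n (by omega)).ne'
    have h1 : (1 - p) * ((N : ℝ) - ((n : ℝ) + 1)) + p * ((n : ℝ) + 1) ≠ 0 := by have := hden (n + 1) hn; push_cast at this; exact this.ne'
    rw [hb n (by omega), hNa, hNa]
    push_cast
    field_simp
    ring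

/-- **KRAWTCHOUK: `Σ x_k = Σ_{n ≤ t} (p(N−n) + (1−p)n)`** for the zeros of `K_{t+1}`. [N298; this file, §1146] -/
theorem krawtchouk_zeros_sum {Q : ℕ → ℝ[X]} {a b : ℕ → ℝ} {p : ℝ} {N : ℕ} (hQ0 : Q 0 = 1) (hQ1 : Q 1 = Polynomial.X - C (a 0))
    (hQrec : ∀ n, Q (n + 2) = (Polynomial.X - C (a (n + 1))) * Q (n + 1) - C (b (n + 1)) * Q n) (ha : ∀ n, a n = p * ((N : ℝ) - n) + (1 - p) * n)
    {t : ℕ} {x : Fin (t + 1) → ℝ} (hxq : Q (t + 1) = ∏ k, (Polynomial.X - C (x k))) :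
    ∑ k, x k = ∑ n ∈ Finset.range (t + 1), (p * ((N : ℝ) - n) + (1 - p) * n) := by
  rw [sum_recurrence_zeros hQ0 hQ1 hQrec hxq]
  exact Finset.sum_congr rfl fun n _ => ha n

end Summit.Ventures.HSemireg.Wedge.HankelOuter
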